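import Summits.QuantumFields.BalabanUV.T4Continuum.Support.NE7FluxHodgeDivForm
import Summits.QuantumFields.BalabanUV.T4Continuum.Support.NE7FlatInteriorEstimateDivForm
import Summits.QuantumFields.BalabanUV.T4Continuum.Support.NE7FlatSupLetterCubeDivForm
import HarnessLib

/-!
# NE7FluxGradInteriorLetter — supplier stub (S-h) of the NE7 crux, part (c4) (ROAD-G108 §4): THE POINTWISE FLUX-GRADIENT LETTER AT A NEAR-FLAT SMALL-FIELD CONFIGURATION FROM ITS
# SMALL CURRENT — «(10) TYPE up to a logarithm» at ONE configuration, in ONE gauge: if a unitary `V` with `‖V(∂p) − 1‖ ≤ a` is `τ`-close to `1` on `cube x₀ (3m+2)` and its Yang–Mills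
# tension (`Σ_μ ∇_μ† B_{μν}`, the covariant codifferential of the flux form) is `≤ T_c` on `cube x₀ (3m+1)`, then at the centre
#   `‖∇_V F(x₀; j, π)‖ ≤ C(d)·[(1 + log m)·(248a² + 12τa + 2(T_c + 4dτa)) + 2a∕m] + 4τa`

Cell `pub-balaban`, rung (B)+1 sub-cell t4, lineage `b2b-balaban-t4-ne7-p1`, generation 108 (CRUX PROVER NE7 #1 = OWNER of BINDER row NE7).  Memo `t4/b2b-balaban-t4-ne7-p1-g108/ROAD-G108.md` §4 (c).
THE ARGUMENT.  Each component `u = B_{μν}` of the flux form solves, EXACTLY, the flat equation `Δu = flatDiv q` of THIS generation's `NE7FluxHodgeDivForm.lap_twoForm_eq_flatDiv`, the source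
`q` being built from the flat exterior derivative and codifferential of `B`; by the zeroth-order near-flat comparison of the same file these are the covariant Bianchi cyclic sum (`≤ 248a²`,
`NE7FluxGradientFromTension.norm_cyc_le`) and MINUS the tension (`≤ T_c`) up to `O(τ·sup‖B‖)`, `sup‖B‖ ≤ 2a` (`norm_fluxForm_le`); so `‖q‖ ≤ Q := 248a² + 12τa + 2(T_c + 4dτa)` on `cube x₀ (3m)`
(`norm_hodgeQ_le`), `r = 0`, `‖u‖ ≤ 2a`, and row NE7b's interior letter with a divergence-form source (`NE7FlatInteriorEstimateDivForm.interior_estimate_divForm`, gen 155) gives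
`‖u(x₀+e_j) − u(x₀)‖ ≤ C((1 + log m)Q + 2a∕m)`; finally `∇_V F(x₀;j,π) = cD_j B_π(x₀)` differs from the flat difference by `≤ 4τa` (`norm_fdiff_sub_cD_le`).  NO bootstrap (`r = 0`).
WHAT ([folklore]; 0 def, 0 sorry; `d ≥ 3`).  **`fluxGrad_interior_letter`** (displayed above; `B` the antisymmetric flux form of `V`, passed with its two characterising hypotheses).
USE ((c5), next): `V = U^{u}` the near-identity gauge of `BlockAverageCurrent.exists_nearId_gauge` around `x₀` (`τ = (d+1)·d(3m+2)·a`), `U` a tangent-critical minimiser (`T_c` = gen 91's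
`NE7CovDivGeneralDatum.norm_tension_gaugeAct_le_of_tanCritical_gen`, `O(εη³)` at `d = 4`), `a = εη²`, `m ≍ M` ⟹ `‖∇_U F‖ ≤ c(1+k)η³` — the log-tolerant (10)-TYPE hypothesis of
`NE7Route1EndDockedSmallDataSU2Log`.
HONEST FRAMING (page 1): a LETTER about ONE configuration under displayed hypotheses (near-flat gauge, small current); NOT yet (10) TYPE for minimisers ((c5) docks it), NOT NE3∕NE7; spine 0∕9;
finite T⁴ rung (B)+1 — NOT infinite volume, NOT mass gap, NOT BetaPertH, NOT Clay.
-/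

set_option autoImplicit false

open scoped BigOperators Matrix Matrix.Norms.L2Operator
open NormedSpace Finset

namespace Summit.QuantumFields.BalabanUV.T4Continuum.NE7FluxGradInteriorLetter

open Literature.MathematicalPhysics.QuantumFieldTheory.Balaban1983to89
open B7Prop1Explicit B7Prop2Explicit
open T4AveragingDeficitWall (IsUnitaryCfg SmallField Ad covGrad flux)
open NE3CovariantCalculus (cD cDstar)
open NE3CoercivityScaling (flatDiv)
open Beta.PoissonInterior (cube mem_cube cube_mono)
open NE7FluxGradientFromTension (norm_cyc_le norm_fluxForm_le)
open NE7FluxHodgeDivForm (lap_twoForm_eq_flatDiv norm_hodgeQ_le norm_fdiff_sub_cD_le covGrad_flux_eq_cD norm_flatCodiff_add_tension_le norm_flatExt_sub_cyc_le)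
open NE7FlatInteriorEstimateDivForm (interior_estimate_divForm)
open NE7FlatSupLetterCubeDivForm (sub_e_mem_cube_succ)

noncomputable section

variable {d : ℕ} {n : Type*} [Fintype n] [DecidableEq n]

set_option maxHeartbeats 800000 in
/-- **THE POINTWISE FLUX-GRADIENT LETTER AT A NEAR-FLAT SMALL-FIELD CONFIGURATION FROM ITS SMALL CURRENT** (statement in the file header). [folklore] -/
theorem fluxGrad_interior_letter [Nonempty n] (hd : 3 ≤ d) : ∃ C : ℝ, 0 ≤ C ∧ ∀ (m : ℕ), 1 ≤ m →
    ∀ (V : Site d → Fin d → (Matrix n n ℂ)ˣ), IsUnitaryCfg V → ∀ (a τ Tc : ℝ), 0 ≤ a → a ≤ 1 / 50 → SmallField V a → 0 ≤ τ → 0 ≤ Tc →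
    ∀ (B : Site d → Fin d → Fin d → Matrix n n ℂ), (∀ (y : Site d) (μ ν : Fin d) (h : μ < ν), B y μ ν = flux V (y, ⟨(μ, ν), h⟩)) →
    (∀ (y : Site d) (μ ν : Fin d), B y ν μ = -B y μ ν) →
    ∀ (x₀ : Site d), (∀ y ∈ cube x₀ (3 * m + 2), ∀ κ : Fin d, ‖((V y κ : (Matrix n n ℂ)ˣ) : Matrix n n ℂ) - 1‖ ≤ τ) →
    (∀ y ∈ cube x₀ (3 * m + 1), ∀ ν : Fin d, ‖∑ μ : Fin d, cDstar V μ (fun w => B w μ ν) y‖ ≤ Tc) →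
    ∀ (j : Fin d) (μ ν : Fin d) (h : μ < ν),
      ‖covGrad V (flux V) x₀ j ⟨(μ, ν), h⟩‖
        ≤ C * ((1 + Real.log (m : ℝ)) * (248 * a ^ 2 + 12 * τ * a + 2 * (Tc + 4 * d * τ * a)) + 2 * a / m) + 4 * τ * a := by
  obtain ⟨C, hC, hint⟩ := interior_estimate_divForm (d := d) (n := n) hd
  refine ⟨C, hC, ?_⟩
  intro m hm V hVu a τ Tc ha ha50 hVa hτ hTc B hBF hanti x₀ hflat hT j μ ν hμν
  have ha2 : a ≤ 1 / 2 := ha50.trans (by norm_num)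
  have hBs : ∀ (y : Site d) (μ' ν' : Fin d), ‖B y μ' ν'‖ ≤ 2 * a := norm_fluxForm_le ha ha2 hVa hBF hanti
  have hcyc : ∀ (y : Site d) (κ μ' ν' : Fin d), ‖cD V κ (fun w => B w μ' ν') y + cD V μ' (fun w => B w ν' κ) y + cD V ν' (fun w => B w κ μ') y‖ ≤ 248 * a ^ 2 :=
    norm_cyc_le hVu ha50 hVa hBF hanti
  -- cube bookkeeping
  have h01 : cube x₀ (3 * m) ⊆ cube x₀ (3 * m + 1) := cube_mono (by omega)
  have h02 : cube x₀ (3 * m) ⊆ cube x₀ (3 * m + 2) := cube_mono (by omega)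
  have h12 : cube x₀ (3 * m + 1) ⊆ cube x₀ (3 * m + 2) := cube_mono (by omega)
  have hx₀ : x₀ ∈ cube x₀ (3 * m + 2) := mem_cube.mpr fun i => by simp only [sub_self, abs_zero]; positivity
  -- (1) the flat exterior derivative at `y ∈ cube x₀ (3m)`
  have hD : ∀ y ∈ cube x₀ (3 * m), ∀ κ : Fin d,
      ‖(B (y + e κ) μ ν - B y μ ν) - (B (y + e μ) κ ν - B y κ ν) + (B (y + e ν) κ μ - B y κ μ)‖ ≤ 248 * a ^ 2 + 12 * τ * a := by
    intro y hy κ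
    have hy2 : y ∈ cube x₀ (3 * m + 2) := h02 hy
    have hcmp := norm_flatExt_sub_cyc_le hVu hanti y κ μ ν
    have t1 : 2 * ‖((V y κ : (Matrix n n ℂ)ˣ) : Matrix n n ℂ) - 1‖ * ‖B (y + e κ) μ ν‖ ≤ 2 * τ * (2 * a) :=
      mul_le_mul (mul_le_mul_of_nonneg_left (hflat y hy2 κ) (by norm_num)) (hBs _ _ _) (norm_nonneg _) (by positivity)
    have t2 : 2 * ‖((V y μ : (Matrix n n ℂ)ˣ) : Matrix n n ℂ) - 1‖ * ‖B (y + e μ) ν κ‖ ≤ 2 * τ * (2 * a) :=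
      mul_le_mul (mul_le_mul_of_nonneg_left (hflat y hy2 μ) (by norm_num)) (hBs _ _ _) (norm_nonneg _) (by positivity)
    have t3 : 2 * ‖((V y ν : (Matrix n n ℂ)ˣ) : Matrix n n ℂ) - 1‖ * ‖B (y + e ν) κ μ‖ ≤ 2 * τ * (2 * a) :=
      mul_le_mul (mul_le_mul_of_nonneg_left (hflat y hy2 ν) (by norm_num)) (hBs _ _ _) (norm_nonneg _) (by positivity)
    have hsub := norm_sub_le_norm_sub_add_norm_sub
      (((B (y + e κ) μ ν - B y μ ν) - (B (y + e μ) κ ν - B y κ ν) + (B (y + e ν) κ μ - B y κ μ)))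
      (cD V κ (fun w => B w μ ν) y + cD V μ (fun w => B w ν κ) y + cD V ν (fun w => B w κ μ) y) 0
    rw [sub_zero, sub_zero] at hsub
    linarith [hcyc y κ μ ν, hsub]
  -- (2) the flat codifferential at `z ∈ cube x₀ (3m+1)`: MINUS the tension up to `4dτa`
  have hT' : ∀ z ∈ cube x₀ (3 * m + 1), ∀ ν' : Fin d, ‖∑ lam : Fin d, (B z lam ν' - B (z - e lam) lam ν')‖ ≤ Tc + 4 * d * τ * a := by
    intro z hz ν'
    have hcmp := norm_flatCodiff_add_tension_le hVu B z ν'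
    have hsum : ∑ κ : Fin d, 2 * ‖((V (z - e κ) κ : (Matrix n n ℂ)ˣ) : Matrix n n ℂ) - 1‖ * ‖B (z - e κ) κ ν'‖ ≤ ∑ _κ : Fin d, 2 * τ * (2 * a) :=
      Finset.sum_le_sum fun κ _ => mul_le_mul (mul_le_mul_of_nonneg_left (hflat (z - e κ) (sub_e_mem_cube_succ hz κ).1 κ) (by norm_num))
        (hBs _ _ _) (norm_nonneg _) (by positivity)
    rw [Finset.sum_const, Finset.card_univ, Fintype.card_fin, nsmul_eq_mul] at hsum
    have hsub : ‖∑ lam : Fin d, (B z lam ν' - B (z - e lam) lam ν')‖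
        ≤ ‖∑ lam : Fin d, (B z lam ν' - B (z - e lam) lam ν') + ∑ κ : Fin d, cDstar V κ (fun w => B w κ ν') z‖
          + ‖∑ κ : Fin d, cDstar V κ (fun w => B w κ ν') z‖ := by
      have := norm_sub_le (∑ lam : Fin d, (B z lam ν' - B (z - e lam) lam ν') + ∑ κ : Fin d, cDstar V κ (fun w => B w κ ν') z)
        (∑ κ : Fin d, cDstar V κ (fun w => B w κ ν') z)
      rwa [add_sub_cancel_right] at this
    have := hT z hz ν'
    linarith
  -- (3) the source letter `Q` on `cube x₀ (3m)`
  set Q : ℝ := 248 * a ^ 2 + 12 * τ * a + 2 * (Tc + 4 * d * τ * a) with hQ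
  have hQ0 : 0 ≤ Q := by positivity
  have hq : ∀ y ∈ cube x₀ (3 * m), ∀ κ : Fin d,
      ‖((B (y + e κ) μ ν - B y μ ν) - (B (y + e μ) κ ν - B y κ ν) + (B (y + e ν) κ μ - B y κ μ))
          + (if κ = μ then ∑ lam : Fin d, (B (y + e μ) lam ν - B (y + e μ - e lam) lam ν) else 0)
          - (if κ = ν then ∑ lam : Fin d, (B (y + e ν) lam μ - B (y + e ν - e lam) lam μ) else 0)‖ ≤ Q := by
    intro y hy κ
    have h := norm_hodgeQ_le B y μ ν κ (hD y hy κ) (by positivity : 0 ≤ Tc + 4 * d * τ * a)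
      (hT' (y + e μ) (sub_e_mem_cube_succ hy μ).2 ν) (hT' (y + e ν) (sub_e_mem_cube_succ hy ν).2 μ)
    rw [hQ]; linarith
  -- (4) the interior letter for the component `u = B_{μν}` (`r = 0`, `S = 2a`)
  have hkey := hint m hm (fun y => B y μ ν)
    (fun y κ => ((B (y + e κ) μ ν - B y μ ν) - (B (y + e μ) κ ν - B y κ ν) + (B (y + e ν) κ μ - B y κ μ))
          + (if κ = μ then ∑ lam : Fin d, (B (y + e μ) lam ν - B (y + e μ - e lam) lam ν) else 0)
          - (if κ = ν then ∑ lam : Fin d, (B (y + e ν) lam μ - B (y + e ν - e lam) lam μ) else 0))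
    (fun _ => 0) x₀ Q 0 (2 * a) hQ0 le_rfl (by positivity)
    (fun y _ => by rw [add_zero]; exact lap_twoForm_eq_flatDiv B y μ ν) hq (fun y _ => by rw [norm_zero]) (fun y _ => hBs y μ ν) j
  -- (5) the covariant gradient at the centre
  rw [covGrad_flux_eq_cD V hBF x₀ j hμν]
  have hcmp := norm_fdiff_sub_cD_le hVu (fun w => B w μ ν) x₀ j
  have t4 : 2 * ‖((V x₀ j : (Matrix n n ℂ)ˣ) : Matrix n n ℂ) - 1‖ * ‖B (x₀ + e j) μ ν‖ ≤ 2 * τ * (2 * a) :=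
    mul_le_mul (mul_le_mul_of_nonneg_left (hflat x₀ hx₀ j) (by norm_num)) (hBs _ _ _) (norm_nonneg _) (by positivity)
  have hsub : ‖cD V j (fun w => B w μ ν) x₀‖ ≤ ‖B (x₀ + e j) μ ν - B x₀ μ ν‖ + ‖(B (x₀ + e j) μ ν - B x₀ μ ν) - cD V j (fun w => B w μ ν) x₀‖ := by
    have := norm_sub_le (B (x₀ + e j) μ ν - B x₀ μ ν) ((B (x₀ + e j) μ ν - B x₀ μ ν) - cD V j (fun w => B w μ ν) x₀)
    rwa [sub_sub_cancel] at this
  have e0 : C * ((1 + Real.log (m : ℝ)) * Q + (m : ℝ) * 0 + 2 * a / m) = C * ((1 + Real.log (m : ℝ)) * Q + 2 * a / m) := by ring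
  rw [e0] at hkey
  rw [hQ] at hkey
  linarith

end

end Summit.QuantumFields.BalabanUV.T4Continuum.NE7FluxGradInteriorLetter
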